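import Literature.Topology.FourManifolds.SmaleHomologySpheresFiveSixKervaireMilnor
import Literature.Topology.FourManifolds.ThetaFourWall
import HarnessLib

/-!
# The Thm. 5.1 (`k = 2`) leaf of `Θ₄ = 0` is dominated by `Θ₄ = 0` and by Wall's Thm. 2 (proofs only)

Topic `Literature/Topology/FourManifolds`; companion to `ThetaFourKervaireMilnor.lean` (and to its
pure-proof file `ThetaFourKervaireMilnorProofs.lean`, the chain over the current frontier), which
decomposes the named fact `Literature.Topology.FourManifolds.isHCobordant_sphere_of_homotopySphere_four`
(`Θ₄ = 0` in Kervaire–Milnor's h-cobordism sense, `ThetaFour.lean`) into leaves, the last of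
which is Kervaire–Milnor's **Theorem 5.1 at `k = 2`**
(`Literature.Topology.FourManifolds.HomotopySphere.boundsContractible_of_nullCobordism_isStablyParallelizable_four`:
a homotopy `4`-sphere bounding an s-parallelizable compact smooth `5`-manifold bounds a
contractible one; M. Kervaire, J. Milnor, *Groups of homotopy spheres I*, Ann. of Math. 77 (1963),
Thm. 5.1, p. 512).

This file records, sorry-free and without any new named fact, where that leaf sits relative to
the other named facts of the tree:

* `HomotopySphere.boundsContractible_of_nullCobordism_isStablyParallelizable_four_of_forall_boundsContractible`
  (**proved**): the leaf is implied by `Θ₄ = 0` in the bounding form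
  (`∀ S : HomotopySphere 4, BoundsContractible 4 S.carrier`, the conclusion of
  `HomotopySphere.boundsContractible_four_of`) — the s-parallelizable null-cobordism in the
  hypothesis of Thm. 5.1 is simply not used; so, over `Θ₄ = bP₅`
  (`HomotopySphere.boundsParallelizable_four_of`), the leaf and the bounding form are equivalent.
* `HomotopySphere.boundsContractible_of_nullCobordism_isStablyParallelizable_four_of_isHCobordant_sphere`
  (**proved**, unconditional implication): the leaf follows from the target fact
  `isHCobordant_sphere_of_homotopySphere_four` itself, through Kervaire–Milnor's Lemma 2.3, both
  directions of which are theorems of the tree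
  (`HomotopySphere.forall_boundsContractible_four_iff_isHCobordant_sphere`,
  `SmaleHomologySpheresFiveSixKervaireMilnor.lean`). Hence any proof of `Θ₄ = 0`, by whatever
  route, discharges this leaf.
* `HomotopySphere.boundsContractible_of_nullCobordism_isStablyParallelizable_four_of_wallThmTwo`
  (**proved**): in particular the leaf follows from the single named fact Wall 1964, Thm. 2
  (`isHCobordant_of_equivalent_intersectionForm`, `HCobordismDonaldson.lean`), through
  `isHCobordant_sphere_of_homotopySphere_four_of_wallThmTwo` (`ThetaFourWall.lean`).

Nothing is discharged. The printed proof of Thm. 5.1 for `k` even — in particular `k = 2` — is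
completed inside §5 (p. 519: "This completes the proof of Theorem 5.1 for `k` even"; §6 and
Thm. 6.6, p. 526, treat `k` odd): kill `π₁` of the bounding `5`-manifold by spherical modifications
`χ(φ)`, `φ : S¹ × D⁴ ↪ M`, keeping s-parallelizability (Lemmas 5.2–5.4, Thm. 5.5, p. 514), then
kill the group `H₂` by alternating Lemma 5.7 (p. 516: infinite cyclic summands are generated by
primitive classes, by Poincaré duality and `H₂(bM) = 0`, and primitive classes can be killed,
Lemma 5.6) with Lemma 5.8 (pp. 516–518: for `k` even every modification changes the `k`-th Betti
number, via the semi-characteristic formula Lemma 5.9), and conclude "from the Poincaré duality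
theorem that `M₁` is contractible" (p. 514). Smooth spherical modifications of a manifold with
boundary (existence of the surgered manifold and of its s-parallelizable framing), Whitney's
embedding theorem with Lemma 3.5, and Lefschetz duality are theories absent from Mathlib and
present in the tree only as relational vocabulary (`FramedSphereFamily.IsSurgery`,
`SphereFamilySurgery.lean`) or named facts (`LefschetzDuality.lean`), so the leaf is not proved
here.

## References

* M. Kervaire, J. Milnor, *Groups of homotopy spheres I*, Ann. of Math. (2) 77 (1963) 504–537:
  Lemma 2.3 (p. 506), table p. 504, Thm. 5.1 (p. 512), §5 (pp. 513–519: Lemmas 5.2–5.9,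
  Thm. 5.5). doi:10.2307/1970128 [KervaireMilnorAnnals1963]
* C. T. C. Wall, *On simply-connected 4-manifolds*, J. London Math. Soc. 39 (1964) 141–149,
  Thm. 2 (p. 141). [WallJLMS1964]
-/

noncomputable section

open scoped Manifold ContDiff

namespace Literature.Topology.FourManifolds

namespace HomotopySphere

/-- **The Thm. 5.1 (`k = 2`) leaf is implied by `Θ₄ = 0` in the bounding form.** If every
homotopy `4`-sphere bounds a contractible manifold (the conclusion of `boundsContractible_four_of`),
then a fortiori every homotopy `4`-sphere bounding an s-parallelizable manifold does
(`boundsContractible_of_nullCobordism_isStablyParallelizable_four`): the s-parallelizable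
null-cobordism in the hypothesis of Kervaire–Milnor's Thm. 5.1 ("If a homotopy sphere of
dimension `2k` bounds an s-parallelizable manifold `M`, then it bounds a contractible manifold
`M₁`", p. 512) is not used. With `boundsContractible_four_of`, over `Θ₄ = bP₅` the leaf and the
bounding form of `Θ₄ = 0` are equivalent.
[cite: KervaireMilnorAnnals1963, Thm. 5.1 (p. 512; proof for k even §5, pp. 513–519)] -/
theorem boundsContractible_of_nullCobordism_isStablyParallelizable_four_of_forall_boundsContractible
    (h : ∀ S : HomotopySphere 4, BoundsContractible 4 S.carrier) :
    boundsContractible_of_nullCobordism_isStablyParallelizable_four :=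
  fun S _ _ => h S

/-- **The Thm. 5.1 (`k = 2`) leaf follows from `Θ₄ = 0` (h-cobordism form), unconditionally.**
If every homotopy `4`-sphere is h-cobordant to `S⁴` (`isHCobordant_sphere_of_homotopySphere_four`,
Kervaire–Milnor's table p. 504), then every homotopy `4`-sphere bounds a contractible manifold by
Lemma 2.3, direction `⇒` (p. 506: "If `M + (-Sⁿ) = bW` then filling in a disk `Dⁿ⁺¹` we obtain a
manifold `W'` with `bW' = M`" — a theorem of the tree, packaged in
`HomotopySphere.forall_boundsContractible_four_iff_isHCobordant_sphere`), and hence Thm. 5.1 at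
`k = 2` in the tree's form holds
(`boundsContractible_of_nullCobordism_isStablyParallelizable_four_of_forall_boundsContractible`).
So the leaf is implied by the very fact it helps decompose
(`isHCobordant_sphere_of_homotopySphere_four_of_leaves`): any proof of `Θ₄ = 0` discharges it.
[cite: KervaireMilnorAnnals1963, Thm. 5.1 (p. 512) with Lemma 2.3 (p. 506) and table p. 504 (Θ₄ = 0)] -/
theorem boundsContractible_of_nullCobordism_isStablyParallelizable_four_of_isHCobordant_sphere
    (hΘ : isHCobordant_sphere_of_homotopySphere_four) :
    boundsContractible_of_nullCobordism_isStablyParallelizable_four :=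
  boundsContractible_of_nullCobordism_isStablyParallelizable_four_of_forall_boundsContractible
    (HomotopySphere.forall_boundsContractible_four_iff_isHCobordant_sphere.mpr hΘ)

/-- **The Thm. 5.1 (`k = 2`) leaf from Wall 1964, Thm. 2 alone.** `ThetaFourWall.lean` proves
`Θ₄ = 0` in the h-cobordism form from Wall's Thm. 2 (C. T. C. Wall, *On simply-connected
4-manifolds*, J. London Math. Soc. 39 (1964), p. 141: "Two simply-connected closed 4-manifolds with
isomorphic quadratic forms are h-cobordant"; tree fact `isHCobordant_of_equivalent_intersectionForm`,
reduction `isHCobordant_sphere_of_homotopySphere_four_of_wallThmTwo`); composed with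
`boundsContractible_of_nullCobordism_isStablyParallelizable_four_of_isHCobordant_sphere` this gives
Kervaire–Milnor's Thm. 5.1 at `k = 2` in the tree's form. So the Thm. 5.1 leaf of
`ThetaFourKervaireMilnor.lean` is dominated by the single named fact Wall's Thm. 2; no leaf is
discharged. [cite: KervaireMilnorAnnals1963, Thm. 5.1 (p. 512) and Lemma 2.3 (p. 506); Wall 1964 Thm. 2 via ThetaFourWall] -/
theorem boundsContractible_of_nullCobordism_isStablyParallelizable_four_of_wallThmTwo
    (hW : isHCobordant_of_equivalent_intersectionForm) :
    boundsContractible_of_nullCobordism_isStablyParallelizable_four :=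
  boundsContractible_of_nullCobordism_isStablyParallelizable_four_of_isHCobordant_sphere
    (isHCobordant_sphere_of_homotopySphere_four_of_wallThmTwo hW)

end HomotopySphere

end Literature.Topology.FourManifolds

end
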